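import Mathlib.MeasureTheory.Measure.Lebesgue.Complex
import Mathlib.Algebra.Order.Archimedean.Basic
import Literature.Topology.PlaneTopology.OsgoodArcGlue
import HarnessLib

/-!
# Osgood arcs II: the cell scheme and its fat dust

Topic: Topology / PlaneTopology. The geometric skeleton of the Osgood arc (W. F. Osgood, *A Jordan
curve of positive area*, Trans. AMS 4 (1903) 107–112; we follow the "fat Cantor dust threaded by
straight bridges" variant).

* Side lengths `width k`, `height k` of a level-`k` cell: starting from `1/2 × 1`, at even levels
  the width and at odd levels the height is multiplied by `ratio k = (k+1)(k+3) / (2(k+2)²) < 1/2`,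
  so that `2ⁿ · width n · height n = (n+2) / (4(n+1)) ≥ 1/4` (`two_pow_mul_width_mul_height`):
  the dust is FAT. `diam k = width k + height k` bounds cell diameters and tends to `0`
  (`diam_eventually_lt`).
* `Cell = (level k, bottom-left corner lo)`; its rectangle `rect`, entry corner `lo`, exit corner
  `lo + width k + height k · i`; its two children `fst` (hugging the entry corner) and `snd`
  (hugging the exit corner), which are disjoint (`disjoint_rect`); the straight *bridge* from the
  exit of `fst` to the entry of `snd` avoids both children except at its end-points
  (`bridge_avoids`).
* `levelSet n Q` = union of the `2ⁿ` depth-`n` sub-cells, `dust Q = ⋂ₙ levelSet n Q`, and the area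
  computation `volume (dust root) ≥ 1/4` (`le_volume_dust_root`) by continuity from above.

All folklore; everything proved. Mathlib anchors: `Complex.volume_preserving_equiv_real_prod`,
`Real.volume_Icc`, `Antitone.measure_iInter`.
-/

noncomputable section

open Set Filter _root_.MeasureTheory

namespace Literature.Topology.PlaneTopology

namespace OsgoodArc

/-! ### Side lengths -/

/-- The contraction ratio used at level `k`: `ratio k = (k+1)(k+3) / (2(k+2)²) < 1/2`, chosen so
that `∏_{j<n} 2 · ratio j = (n+2) / (2(n+1))` stays bounded away from `0`. [folklore] -/
def ratio (k : ℕ) : ℝ := ((k + 1) * (k + 3)) / (2 * (k + 2) ^ 2)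

/-- The ratio is positive. [folklore] -/
theorem ratio_pos (k : ℕ) : 0 < ratio k := by unfold ratio; positivity

/-- The ratio is `< 1/2` (this leaves a gap between the two children). [folklore] -/
theorem ratio_lt_half (k : ℕ) : ratio k < 1 / 2 := by
  unfold ratio
  rw [div_lt_iff₀ (by positivity)]
  nlinarith

/-- The ratio is `< 1`. [folklore] -/
theorem ratio_lt_one (k : ℕ) : ratio k < 1 := (ratio_lt_half k).trans (by norm_num)

/-- Width of a level-`k` cell: contracted by `ratio k` at even levels `k`. [folklore] -/
def width : ℕ → ℝ
  | 0 => 1 / 2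
  | k + 1 => if k % 2 = 0 then ratio k * width k else width k

/-- Height of a level-`k` cell: contracted by `ratio k` at odd levels `k`. [folklore] -/
def height : ℕ → ℝ
  | 0 => 1
  | k + 1 => if k % 2 = 0 then height k else ratio k * height k

/-- Widths are positive. [folklore] -/
theorem width_pos : ∀ k, 0 < width k
  | 0 => by norm_num [width]
  | k + 1 => by
    unfold width; split_ifs
    · exact mul_pos (ratio_pos k) (width_pos k)
    · exact width_pos k

/-- Heights are positive. [folklore] -/
theorem height_pos : ∀ k, 0 < height k
  | 0 => by norm_num [height]
  | k + 1 => by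
    unfold height; split_ifs
    · exact height_pos k
    · exact mul_pos (ratio_pos k) (height_pos k)

/-- Widths decrease. [folklore] -/
theorem width_succ_le (k : ℕ) : width (k + 1) ≤ width k := by
  change (if k % 2 = 0 then ratio k * width k else width k) ≤ width k
  split_ifs
  · exact mul_le_of_le_one_left (width_pos k).le (ratio_lt_one k).le
  · exact le_rfl

/-- Heights decrease. [folklore] -/
theorem height_succ_le (k : ℕ) : height (k + 1) ≤ height k := by
  change (if k % 2 = 0 then height k else ratio k * height k) ≤ height k
  split_ifs
  · exact le_rfl
  · exact mul_le_of_le_one_left (height_pos k).le (ratio_lt_one k).le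

/-- At every level one of the two side lengths is contracted by more than one half; this is what
separates the two children of a cell. [folklore] -/
theorem two_mul_succ_lt_or (k : ℕ) :
    2 * width (k + 1) < width k ∨ 2 * height (k + 1) < height k := by
  change 2 * (if k % 2 = 0 then ratio k * width k else width k) < width k ∨
    2 * (if k % 2 = 0 then height k else ratio k * height k) < height k
  split_ifs
  · left; nlinarith [width_pos k, ratio_lt_half k, ratio_pos k]
  · right; nlinarith [height_pos k, ratio_lt_half k, ratio_pos k]

/-- Each level multiplies the cell area by `ratio k`. [folklore] -/
theorem width_succ_mul_height_succ (k : ℕ) :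
    width (k + 1) * height (k + 1) = ratio k * (width k * height k) := by
  change (if k % 2 = 0 then ratio k * width k else width k) *
    (if k % 2 = 0 then height k else ratio k * height k) = _
  split_ifs <;> ring

/-- **Area bookkeeping**: `2ⁿ · width n · height n = (n + 2) / (4 (n + 1))`. [folklore] -/
theorem two_pow_mul_width_mul_height (n : ℕ) :
    2 ^ n * (width n * height n) = (n + 2) / (4 * (n + 1)) := by
  induction n with
  | zero => norm_num [width, height]
  | succ n ih =>
    rw [width_succ_mul_height_succ, pow_succ, show (2 : ℝ) ^ n * 2 * (ratio n * (width n *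
      height n)) = 2 * ratio n * (2 ^ n * (width n * height n)) by ring, ih, ratio]
    push_cast
    field_simp
    ring

/-- Two levels at least halve the width. [folklore] -/
theorem width_add_two_le (k : ℕ) : width (k + 2) ≤ width k / 2 := by
  change (if (k + 1) % 2 = 0 then ratio (k + 1) * (if k % 2 = 0 then ratio k * width k else width k)
    else (if k % 2 = 0 then ratio k * width k else width k)) ≤ width k / 2
  by_cases h : k % 2 = 0
  · have h' : ¬ (k + 1) % 2 = 0 := by omega
    rw [if_neg h', if_pos h]
    nlinarith [width_pos k, ratio_lt_half k]
  · have h' : (k + 1) % 2 = 0 := by omega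
    rw [if_pos h', if_neg h]
    nlinarith [width_pos k, ratio_lt_half (k + 1)]

/-- Two levels at least halve the height. [folklore] -/
theorem height_add_two_le (k : ℕ) : height (k + 2) ≤ height k / 2 := by
  change (if (k + 1) % 2 = 0 then (if k % 2 = 0 then height k else ratio k * height k)
    else ratio (k + 1) * (if k % 2 = 0 then height k else ratio k * height k)) ≤ height k / 2
  by_cases h : k % 2 = 0
  · have h' : ¬ (k + 1) % 2 = 0 := by omega
    rw [if_neg h', if_pos h]
    nlinarith [height_pos k, ratio_lt_half (k + 1)]
  · have h' : (k + 1) % 2 = 0 := by omega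
    rw [if_pos h', if_neg h]
    nlinarith [height_pos k, ratio_lt_half k]

/-- `diam k = width k + height k` bounds the diameter of a level-`k` cell. [folklore] -/
def diam (k : ℕ) : ℝ := width k + height k

/-- The diameter bound is positive. [folklore] -/
theorem diam_pos (k : ℕ) : 0 < diam k := add_pos (width_pos k) (height_pos k)

/-- The diameter bound decreases. [folklore] -/
theorem diam_succ_le (k : ℕ) : diam (k + 1) ≤ diam k :=
  add_le_add (width_succ_le k) (height_succ_le k)

/-- The diameter bound is antitone. [folklore] -/
theorem diam_antitone : Antitone diam := antitone_nat_of_succ_le diam_succ_le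

/-- Two levels at least halve the diameter bound. [folklore] -/
theorem diam_add_two_le (k : ℕ) : diam (k + 2) ≤ diam k / 2 := by
  unfold diam; linarith [width_add_two_le k, height_add_two_le k]

/-- Geometric decay of the diameter bound along even levels. [folklore] -/
theorem diam_two_mul_le (m : ℕ) : diam (2 * m) ≤ 3 / 2 * (1 / 2) ^ m := by
  induction m with
  | zero => norm_num [diam, width, height]
  | succ m ih =>
    rw [show 2 * (m + 1) = 2 * m + 2 by ring, pow_succ]
    linarith [diam_add_two_le (2 * m)]

/-- **Cell diameters tend to zero.** [folklore] -/
theorem diam_eventually_lt {ε : ℝ} (hε : 0 < ε) : ∃ N : ℕ, ∀ k, N ≤ k → diam k < ε := by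
  obtain ⟨m, hm⟩ := exists_pow_lt_of_lt_one (show 0 < ε / 2 by positivity)
    (show (1 / 2 : ℝ) < 1 by norm_num)
  refine ⟨2 * m, fun k hk => ?_⟩
  calc diam k ≤ diam (2 * m) := diam_antitone hk
    _ ≤ 3 / 2 * (1 / 2) ^ m := diam_two_mul_le m
    _ < ε := by linarith

/-! ### Cells -/

/-- A cell of the construction: its level `k` (which fixes its side lengths
`width k × height k`) and its bottom-left corner `lo`. The curve enters a cell at `lo` and leaves
at the opposite corner. [folklore] -/
structure Cell where
  /-- the level of the cell -/
  k : ℕ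
  /-- the bottom-left corner of the cell -/
  lo : ℂ

namespace Cell

/-- The closed rectangle `[lo.re, lo.re + width k] × [lo.im, lo.im + height k]` of a cell.
[folklore] -/
def rect (Q : Cell) : Set ℂ :=
  Icc Q.lo.re (Q.lo.re + width Q.k) ×ℂ Icc Q.lo.im (Q.lo.im + height Q.k)

/-- Entry point of a cell (its bottom-left corner). [folklore] -/
def entry (Q : Cell) : ℂ := Q.lo

/-- Exit point of a cell (its top-right corner). [folklore] -/
def exit (Q : Cell) : ℂ := Q.lo + width Q.k + height Q.k * Complex.I

/-- The offset of the second child inside a level-`k` cell: the first child hugs the bottom-left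
corner, the second child hugs the top-right corner of the parent. [folklore] -/
def shift (k : ℕ) : ℂ :=
  (width k - width (k + 1) : ℝ) + (height k - height (k + 1) : ℝ) * Complex.I

/-- First child (visited first). [folklore] -/
def fst (Q : Cell) : Cell := ⟨Q.k + 1, Q.lo⟩

/-- Second child (visited last). [folklore] -/
def snd (Q : Cell) : Cell := ⟨Q.k + 1, Q.lo + shift Q.k⟩

variable (Q : Cell)

/-- Level of the first child. [folklore] -/
@[simp] theorem fst_k : Q.fst.k = Q.k + 1 := rfl

/-- Level of the second child. [folklore] -/
@[simp] theorem snd_k : Q.snd.k = Q.k + 1 := rfl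

/-- Corner of the first child. [folklore] -/
@[simp] theorem fst_lo : Q.fst.lo = Q.lo := rfl

/-- Corner of the second child. [folklore] -/
@[simp] theorem snd_lo : Q.snd.lo = Q.lo + shift Q.k := rfl

/-- Real part of the offset. [folklore] -/
@[simp] theorem shift_re (k : ℕ) : (shift k).re = width k - width (k + 1) := by simp [shift]

/-- Imaginary part of the offset. [folklore] -/
@[simp] theorem shift_im (k : ℕ) : (shift k).im = height k - height (k + 1) := by simp [shift]

/-- The entry point is the corner `lo`. [folklore] -/
@[simp] theorem entry_eq : Q.entry = Q.lo := rfl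

/-- Real part of the exit point. [folklore] -/
@[simp] theorem exit_re : Q.exit.re = Q.lo.re + width Q.k := by simp [exit]

/-- Imaginary part of the exit point. [folklore] -/
@[simp] theorem exit_im : Q.exit.im = Q.lo.im + height Q.k := by simp [exit]

/-- Membership in the rectangle of a cell, spelled out. [folklore] -/
theorem mem_rect {z : ℂ} : z ∈ Q.rect ↔ (Q.lo.re ≤ z.re ∧ z.re ≤ Q.lo.re + width Q.k) ∧
    (Q.lo.im ≤ z.im ∧ z.im ≤ Q.lo.im + height Q.k) := Iff.rfl

/-- The rectangle of a cell is closed. [folklore] -/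
theorem isClosed_rect : IsClosed Q.rect := isClosed_box _ _ _ _

/-- The entry point lies in the cell. [folklore] -/
theorem entry_mem_rect : Q.entry ∈ Q.rect := by
  rw [mem_rect, entry_eq]
  exact ⟨⟨le_rfl, by linarith [width_pos Q.k]⟩, le_rfl, by linarith [height_pos Q.k]⟩

/-- The exit point lies in the cell. [folklore] -/
theorem exit_mem_rect : Q.exit ∈ Q.rect := by
  rw [mem_rect, exit_re, exit_im]
  exact ⟨⟨by linarith [width_pos Q.k], le_rfl⟩, by linarith [height_pos Q.k], le_rfl⟩

/-- The first child lies in the parent. [folklore] -/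
theorem fst_rect_subset : Q.fst.rect ⊆ Q.rect := by
  intro z hz
  rw [mem_rect] at hz ⊢
  simp only [fst_lo, fst_k] at hz
  have := width_succ_le Q.k; have := height_succ_le Q.k
  exact ⟨⟨hz.1.1, by linarith [hz.1.2]⟩, hz.2.1, by linarith [hz.2.2]⟩

/-- The second child lies in the parent. [folklore] -/
theorem snd_rect_subset : Q.snd.rect ⊆ Q.rect := by
  intro z hz
  rw [mem_rect] at hz ⊢
  simp only [snd_lo, snd_k, Complex.add_re, shift_re, Complex.add_im, shift_im] at hz
  have := width_succ_le Q.k; have := height_succ_le Q.k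
  have := width_pos (Q.k + 1); have := height_pos (Q.k + 1)
  exact ⟨⟨by linarith [hz.1.1], by linarith [hz.1.2]⟩, by linarith [hz.2.1], by linarith [hz.2.2]⟩

/-- **The two children of a cell are disjoint.** [folklore] -/
theorem disjoint_rect : Disjoint Q.fst.rect Q.snd.rect := by
  rw [Set.disjoint_left]
  intro z h1 h2
  rw [mem_rect] at h1 h2
  simp only [fst_lo, fst_k, snd_lo, snd_k, Complex.add_re, shift_re, Complex.add_im,
    shift_im] at h1 h2
  rcases two_mul_succ_lt_or Q.k with h | h
  · linarith [h1.1.2, h2.1.1]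
  · linarith [h1.2.2, h2.2.1]

/-- The end-points of the bridge differ. [folklore] -/
theorem fst_exit_ne_snd_entry : Q.fst.exit ≠ Q.snd.entry := by
  intro h
  have hre := congrArg Complex.re h
  have him := congrArg Complex.im h
  simp only [exit_re, exit_im, fst_lo, fst_k, entry_eq, snd_lo, Complex.add_re, shift_re,
    Complex.add_im, shift_im] at hre him
  rcases two_mul_succ_lt_or Q.k with h' | h' <;> linarith

/-- Real part along the bridge. [folklore] -/
theorem bridge_re (u : ℝ) : (seg Q.fst.exit Q.snd.entry u).re =
    Q.lo.re + width (Q.k + 1) + u * (width Q.k - 2 * width (Q.k + 1)) := by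
  rw [seg_re]; simp only [exit_re, fst_lo, fst_k, entry_eq, snd_lo, Complex.add_re, shift_re]; ring

/-- Imaginary part along the bridge. [folklore] -/
theorem bridge_im (u : ℝ) : (seg Q.fst.exit Q.snd.entry u).im =
    Q.lo.im + height (Q.k + 1) + u * (height Q.k - 2 * height (Q.k + 1)) := by
  rw [seg_im]; simp only [exit_im, fst_lo, fst_k, entry_eq, snd_lo, Complex.add_im, shift_im]; ring

/-- **The open bridge avoids both children.** [folklore] -/
theorem bridge_avoids {u : ℝ} (hu : u ∈ Ioo (0 : ℝ) 1) :
    seg Q.fst.exit Q.snd.entry u ∉ Q.fst.rect ∧ seg Q.fst.exit Q.snd.entry u ∉ Q.snd.rect := by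
  obtain ⟨hu0, hu1⟩ := hu
  have hre := Q.bridge_re u
  have him := Q.bridge_im u
  set z := seg Q.fst.exit Q.snd.entry u with hz_def
  constructor <;> intro hz <;> rw [mem_rect] at hz
  · simp only [fst_lo, fst_k] at hz
    rcases two_mul_succ_lt_or Q.k with h | h
    · nlinarith [hz.1.2]
    · nlinarith [hz.2.2]
  · simp only [snd_lo, snd_k, Complex.add_re, shift_re, Complex.add_im, shift_im] at hz
    rcases two_mul_succ_lt_or Q.k with h | h
    · nlinarith [hz.1.1]
    · nlinarith [hz.2.1]

/-- The bridge stays in the parent cell. [folklore] -/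
theorem bridge_mem_rect {u : ℝ} (hu : u ∈ Icc (0 : ℝ) 1) :
    seg Q.fst.exit Q.snd.entry u ∈ Q.rect :=
  seg_mem_box (Q.fst_rect_subset Q.fst.exit_mem_rect) (Q.snd_rect_subset Q.snd.entry_mem_rect) hu

/-- Two points of a cell are at distance at most `diam k`. [folklore] -/
theorem dist_le_diam {z w : ℂ} (hz : z ∈ Q.rect) (hw : w ∈ Q.rect) : dist z w ≤ diam Q.k := by
  have := dist_le_of_mem_box hz hw
  simp only [diam]; linarith

/-- The exit of the second child is the exit of the parent. [folklore] -/
@[simp] theorem snd_exit : Q.snd.exit = Q.exit := by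
  apply Complex.ext <;> simp [exit, shift] <;> ring

/-- The entry of the first child is the entry of the parent. [folklore] -/
@[simp] theorem fst_entry : Q.fst.entry = Q.entry := rfl

end Cell

/-! ### The fat dust: level sets and their area -/

/-- The union of the depth-`n` sub-cells of `Q` (binary recursion over the two children).
[folklore] -/
def levelSet : ℕ → Cell → Set ℂ
  | 0, Q => Q.rect
  | n + 1, Q => levelSet n Q.fst ∪ levelSet n Q.snd

/-- The dust of a cell: the points lying in sub-cells of every depth. [folklore] -/
def dust (Q : Cell) : Set ℂ := ⋂ n, levelSet n Q

/-- Level sets lie in the cell. [folklore] -/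
theorem levelSet_subset_rect : ∀ (n : ℕ) (Q : Cell), levelSet n Q ⊆ Q.rect
  | 0, _ => subset_rfl
  | n + 1, Q => union_subset ((levelSet_subset_rect n Q.fst).trans Q.fst_rect_subset)
      ((levelSet_subset_rect n Q.snd).trans Q.snd_rect_subset)

/-- Level sets are closed. [folklore] -/
theorem isClosed_levelSet : ∀ (n : ℕ) (Q : Cell), IsClosed (levelSet n Q)
  | 0, Q => Q.isClosed_rect
  | n + 1, Q => (isClosed_levelSet n Q.fst).union (isClosed_levelSet n Q.snd)

/-- Level sets decrease with the depth. [folklore] -/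
theorem levelSet_succ_subset : ∀ (n : ℕ) (Q : Cell), levelSet (n + 1) Q ⊆ levelSet n Q
  | 0, Q => union_subset Q.fst_rect_subset Q.snd_rect_subset
  | n + 1, Q => union_subset_union (levelSet_succ_subset n Q.fst) (levelSet_succ_subset n Q.snd)

/-- Level sets form an antitone sequence. [folklore] -/
theorem antitone_levelSet (Q : Cell) : Antitone fun n => levelSet n Q :=
  antitone_nat_of_succ_le fun n => levelSet_succ_subset n Q

/-- Lebesgue measure of a closed coordinate box. [folklore] -/
theorem volume_box {a b c d : ℝ} :
    volume (Icc a b ×ℂ Icc c d) = ENNReal.ofReal (b - a) * ENNReal.ofReal (d - c) := by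
  rw [show Icc a b ×ℂ Icc c d = Complex.measurableEquivRealProd ⁻¹' (Icc a b ×ˢ Icc c d) from rfl,
    Complex.volume_preserving_equiv_real_prod.measure_preimage_equiv, Measure.volume_eq_prod,
    Measure.prod_prod, Real.volume_Icc, Real.volume_Icc]

/-- Area of a cell. [folklore] -/
theorem volume_rect (Q : Cell) : volume Q.rect = ENNReal.ofReal (width Q.k * height Q.k) := by
  rw [Cell.rect, volume_box, ← ENNReal.ofReal_mul (by linarith [width_pos Q.k])]
  congr 1; ring

/-- All depth-`n` sub-cells together have area `2ⁿ · width (k+n) · height (k+n)`. [folklore] -/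
theorem volume_levelSet : ∀ (n : ℕ) (Q : Cell),
    volume (levelSet n Q) = ENNReal.ofReal (2 ^ n * (width (Q.k + n) * height (Q.k + n)))
  | 0, Q => by simp [levelSet, volume_rect]
  | n + 1, Q => by
    have hd : Disjoint (levelSet n Q.fst) (levelSet n Q.snd) :=
      Q.disjoint_rect.mono (levelSet_subset_rect n _) (levelSet_subset_rect n _)
    have hnn : 0 ≤ 2 ^ n * (width (Q.k + 1 + n) * height (Q.k + 1 + n)) := by
      have := width_pos (Q.k + 1 + n); have := height_pos (Q.k + 1 + n); positivity
    rw [levelSet, measure_union hd (isClosed_levelSet n _).measurableSet, volume_levelSet n Q.fst,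
      volume_levelSet n Q.snd, Cell.fst_k, Cell.snd_k, ← ENNReal.ofReal_add hnn hnn,
      show Q.k + 1 + n = Q.k + (n + 1) by ring]
    congr 1; ring

/-- The root cell of the construction: `[0, 1/2] × [0, 1]`. [folklore] -/
def root : Cell := ⟨0, 0⟩

/-- The root has level `0`. [folklore] -/
@[simp] theorem root_k : root.k = 0 := rfl

/-- The root has corner `0`. [folklore] -/
@[simp] theorem root_lo : root.lo = 0 := rfl

/-- Area of the depth-`n` level set of the root: `(n+2) / (4(n+1))`. [folklore] -/
theorem volume_levelSet_root (n : ℕ) :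
    volume (levelSet n root) = ENNReal.ofReal ((n + 2) / (4 * (n + 1))) := by
  rw [volume_levelSet, root_k, zero_add, two_pow_mul_width_mul_height]

/-- **The dust is fat**: it has Lebesgue measure at least `1/4`. [folklore] -/
theorem le_volume_dust_root : ENNReal.ofReal (1 / 4) ≤ volume (dust root) := by
  rw [dust, (antitone_levelSet root).measure_iInter
    (fun n => (isClosed_levelSet n root).measurableSet.nullMeasurableSet)
    ⟨0, by rw [volume_levelSet_root]; exact ENNReal.ofReal_ne_top⟩]
  refine le_iInf fun n => ?_
  rw [volume_levelSet_root]
  apply ENNReal.ofReal_le_ofReal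
  rw [div_le_div_iff₀ (by norm_num) (by positivity)]
  linarith

/-- The dust of the root cell has positive area. [folklore] -/
theorem volume_dust_root_pos : 0 < volume (dust root) :=
  lt_of_lt_of_le (by simp) le_volume_dust_root

end OsgoodArc

end Literature.Topology.PlaneTopology
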